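import Summits.CriticalPhenomena.PercolationContinuityZ3.Theorems.PercNearOneGluingNoHeavyLowerTailThreePointVarianceCutVertex
import HarnessLib

/-!
# The three-point variance row passes from a cut vertex to every vertex behind it — every finite weighted graph

Support file for crux `stmt-CriticalPhenomena-4575` (`NoHeavyLowerTail`), seat `prim-l12-p1` gen 16 (`--supports stmt-CriticalPhenomena-4575`).
Memo `run/shared/lean/prim/prim-l12/FROM-prim-l12-p1-g16-SHARP-3PT.md` §2.

Bond percolation `μ = prodBernoulli w` (arbitrary pair weights, finite vertex type `V`).  Write
`(3PT)(a,b;c) :  P(a↔b)·P(a↮b) ≤ P(a↔b, a↮c) + P(a↔c, a↮b) + P(b↔c, a↮b)`  (the three-point variance row with third vertex `c`; conjectured ∀n,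
kernel n ≤ 5 in gen 15, proved ∀n for `N(c) ⊆ {a,b}` and for `c` separating `a` from `b` in gen 16).  REDUCTION LEMMA [this work]: if `c` lies BEHIND a
vertex `v` — there is a vertex set `S ∋ c` with `v, a, b ∉ S` and every pair between `S` and `V ∖ (S ∪ {v})` of weight `0` — then
`(3PT)(a,b;v) ⟹ (3PT)(a,b;c)`.  (With the cut-vertex theorem this gives, e.g., (3PT) at every third vertex of every weighted tree, by hand.)
Proof: off a null set `{a↔c} = {a↔v outside S} ∩ {v↔c inside S ∪ {v}}`, `{b↔c}` likewise, `{a↔b} = {a↔b outside S}`, and the inside event is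
independent of the outside ones (probability `r`); hence the right side for `c` is `≥ θ(1−r) + r·(right side for v) ≥ θ(1−r) + rθ(1−θ) ≥ θ(1−θ)`.

Main results: `walk_outside`, `threePointVariance_behindCutVertex`.
-/

namespace Summit.CriticalPhenomena.PercolationContinuityZ3.Theorems.ThreePointVarianceBehindCutVertex

open MeasureTheory Set
open Literature.Probability.Percolation Literature.Probability.LatticeModels
open Summit.CriticalPhenomena.PercolationContinuityZ3.Theorems.ThreePointVarianceCutVertex

variable {V : Type*} [Fintype V] [DecidableEq V]

section walks
variable {S : Finset V} {v : V} {ω : BondConfig V}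

/-- **Outside-to-outside connections stay outside `S`** (off the null event `bad S v`): an open walk between two vertices outside `S` can enter `S`
only through `v` and must leave through `v`. [this work] -/
theorem walk_outside (hv : v ∉ S) (hN : ω ∉ bad S v) {y : V} (hy : y ∉ S) :
    ∀ {u x : V} (_ : (openGraph ω).Walk u x), x = y →
      (u ∉ S → ω ∈ reachIn (Finset.univ.filter fun z => z ∉ S) u y) ∧ (u ∈ S → ω ∈ reachIn (Finset.univ.filter fun z => z ∉ S) v y) := by
  intro u x p
  induction p with
  | nil => intro hx; subst hx; exact ⟨fun _ => SimpleGraph.Reachable.refl _, fun hu => (hy hu).elim⟩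
  | @cons u z x' h p' ih =>
    intro hx
    have h' := (openGraph_adj ω u z).1 h
    obtain ⟨ih1, ih2⟩ := ih hx
    constructor
    · intro hu
      by_cases hzS : z ∈ S
      · -- the pair u–z crosses into S: u must be v
        by_cases huv : u = v
        · subst huv; exact ih2 hzS
        · exact (hN ⟨z, u, hzS, hu, huv, by rw [Sym2.eq_swap]; exact h'.1⟩).elim
      · have hu' : u ∈ Finset.univ.filter fun z => z ∉ S := by simp [hu]
        have hz' : z ∈ Finset.univ.filter fun z => z ∉ S := by simp [hzS]
        exact (adj_restr h hu' hz').reachable.trans (ih1 hzS)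
    · intro hu
      by_cases hzS : z ∈ S
      · exact ih2 hzS
      · by_cases hzv : z = v
        · subst hzv; exact ih1 hv
        · exact (hN ⟨u, z, hu, hzS, hzv, h'.1⟩).elim

variable {a b c : V}

/-- Off the null event, for `a, b ∉ S`: `a ↔ b` iff `a ↔ b` outside `S`. [this work] -/
theorem openConn_out_iff (hv : v ∉ S) (hN : ω ∉ bad S v) (ha : a ∉ S) (hb : b ∉ S) :
    ω ∈ openConn a b ↔ ω ∈ reachIn (Finset.univ.filter fun z => z ∉ S) a b :=
  ⟨fun ⟨p⟩ => (walk_outside hv hN hb p rfl).1 ha, fun h => reachable_of_reachIn h⟩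

/-- Off the null event, for `a ∉ S`, `c ∈ S`: `a ↔ c` iff `a ↔ v` outside `S` and `v ↔ c` inside `S ∪ {v}`. [this work] -/
theorem openConn_ac_iff (hv : v ∉ S) (hN : ω ∉ bad S v) (ha : a ∉ S) (hc : c ∈ S) :
    ω ∈ openConn a c ↔ ω ∈ reachIn (Finset.univ.filter fun z => z ∉ S) a v ∧ ω ∈ reachIn (insert v S) c v := by
  constructor
  · rintro h
    obtain ⟨p⟩ := SimpleGraph.Reachable.symm h
    -- the walk c → a leaves S through v
    obtain ⟨h1, h2⟩ := through_c (c := v) hN ha p rfl hc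
    refine ⟨?_, (ThreePointVarianceCutVertex.openConn_ac_iff hc hv hN).1 h1⟩
    obtain ⟨q⟩ := h2.symm
    exact (walk_outside hv hN hv q rfl).1 ha
  · rintro ⟨h1, h2⟩
    exact (reachable_of_reachIn h1).trans (reachable_of_reachIn h2).symm

end walks

/-- **Reduction lemma**: `(3PT)(a,b;v) ⟹ (3PT)(a,b;c)` whenever `c` lies behind `v` (a set `S ∋ c` with `v,a,b ∉ S` whose pairs to
`V ∖ (S ∪ {v})` all have weight `0`), on every finite weighted graph. [this work] -/
theorem threePointVariance_behindCutVertex (w : Sym2 V → unitInterval) {a b c v : V} (S : Finset V) (hc : c ∈ S) (hv : v ∉ S)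
    (ha : a ∉ S) (hb : b ∉ S) (hw : ∀ u ∈ S, ∀ x, x ∉ S → x ≠ v → (w s(u, x) : ℝ) = 0)
    (hyp : (prodBernoulli w).real (openConn a b) * (prodBernoulli w).real (openConn a b)ᶜ ≤
      (prodBernoulli w).real (openConn a b ∩ (openConn a v)ᶜ) + (prodBernoulli w).real (openConn a v ∩ (openConn a b)ᶜ) +
        (prodBernoulli w).real (openConn b v ∩ (openConn a b)ᶜ)) :
    (prodBernoulli w).real (openConn a b) * (prodBernoulli w).real (openConn a b)ᶜ ≤
      (prodBernoulli w).real (openConn a b ∩ (openConn a c)ᶜ) + (prodBernoulli w).real (openConn a c ∩ (openConn a b)ᶜ) +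
        (prodBernoulli w).real (openConn b c ∩ (openConn a b)ᶜ) := by
  have hN : (prodBernoulli w).real (bad S v) = 0 := real_bad w S v hw
  set T := (Finset.univ.filter fun z => z ∉ S) with hT
  set AB := reachIn T a b with hAB
  set AV := reachIn T a v with hAV
  set BV := reachIn T b v with hBV
  set In := reachIn (insert v S) c v with hIn
  have hdAB : DeterminedBy AB (↑(pairsIn T) : Set (Sym2 V)) := determinedBy_reachIn T a b
  have hdAV : DeterminedBy AV (↑(pairsIn T) : Set (Sym2 V)) := determinedBy_reachIn T a v
  have hdBV : DeterminedBy BV (↑(pairsIn T) : Set (Sym2 V)) := determinedBy_reachIn T b v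
  have hdIn : DeterminedBy In (↑(pairsIn (insert v S)) : Set (Sym2 V)) := determinedBy_reachIn _ c v
  have hind : ∀ {X : Set (BondConfig V)}, DeterminedBy X (↑(pairsIn T) : Set (Sym2 V)) →
      (prodBernoulli w).real (In ∩ X) = (prodBernoulli w).real In * (prodBernoulli w).real X :=
    fun hX => prodBernoulli_real_inter_of_determinedBy_disjoint w (disjoint_pairsIn S v hv) hdIn hX
      MeasurableSet.of_discrete MeasurableSet.of_discrete
  -- shorthand for "equal off the null set"
  have nul := real_inter_compl_of_null w hN
  -- (0) the out-events agree with the true events off the null set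
  have e_ab : openConn a b ∩ (bad S v)ᶜ = AB ∩ (bad S v)ᶜ := by
    ext ω; simp only [mem_inter_iff, mem_compl_iff]
    exact ⟨fun ⟨h, hn⟩ => ⟨(openConn_out_iff hv hn ha hb).1 h, hn⟩, fun ⟨h, hn⟩ => ⟨(openConn_out_iff hv hn ha hb).2 h, hn⟩⟩
  have e_abav : openConn a b ∩ (openConn a v)ᶜ ∩ (bad S v)ᶜ = (AB ∩ AVᶜ) ∩ (bad S v)ᶜ := by
    ext ω; simp only [mem_inter_iff, mem_compl_iff]
    constructor
    · rintro ⟨⟨h1, h2⟩, hn⟩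
      exact ⟨⟨(openConn_out_iff hv hn ha hb).1 h1, fun h => h2 ((openConn_out_iff hv hn ha hv).2 h)⟩, hn⟩
    · rintro ⟨⟨h1, h2⟩, hn⟩
      exact ⟨⟨(openConn_out_iff hv hn ha hb).2 h1, fun h => h2 ((openConn_out_iff hv hn ha hv).1 h)⟩, hn⟩
  have e_avab : openConn a v ∩ (openConn a b)ᶜ ∩ (bad S v)ᶜ = (AV ∩ ABᶜ) ∩ (bad S v)ᶜ := by
    ext ω; simp only [mem_inter_iff, mem_compl_iff]
    constructor
    · rintro ⟨⟨h1, h2⟩, hn⟩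
      exact ⟨⟨(openConn_out_iff hv hn ha hv).1 h1, fun h => h2 ((openConn_out_iff hv hn ha hb).2 h)⟩, hn⟩
    · rintro ⟨⟨h1, h2⟩, hn⟩
      exact ⟨⟨(openConn_out_iff hv hn ha hv).2 h1, fun h => h2 ((openConn_out_iff hv hn ha hb).1 h)⟩, hn⟩
  have e_bvab : openConn b v ∩ (openConn a b)ᶜ ∩ (bad S v)ᶜ = (BV ∩ ABᶜ) ∩ (bad S v)ᶜ := by
    ext ω; simp only [mem_inter_iff, mem_compl_iff]
    constructor
    · rintro ⟨⟨h1, h2⟩, hn⟩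
      exact ⟨⟨(openConn_out_iff hv hn hb hv).1 h1, fun h => h2 ((openConn_out_iff hv hn ha hb).2 h)⟩, hn⟩
    · rintro ⟨⟨h1, h2⟩, hn⟩
      exact ⟨⟨(openConn_out_iff hv hn hb hv).2 h1, fun h => h2 ((openConn_out_iff hv hn ha hb).1 h)⟩, hn⟩
  -- (1) the three c-cells contain products of In with out-events (off the null set)
  have s_ac : (In ∩ (AV ∩ ABᶜ)) ∩ (bad S v)ᶜ ⊆ openConn a c ∩ (openConn a b)ᶜ := by
    rintro ω ⟨⟨hin, h1, h2⟩, hn⟩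
    exact ⟨(openConn_ac_iff hv hn ha hc).2 ⟨h1, hin⟩, fun h => h2 ((openConn_out_iff hv hn ha hb).1 h)⟩
  have s_bc : (In ∩ (BV ∩ ABᶜ)) ∩ (bad S v)ᶜ ⊆ openConn b c ∩ (openConn a b)ᶜ := by
    rintro ω ⟨⟨hin, h1, h2⟩, hn⟩
    exact ⟨(openConn_ac_iff hv hn hb hc).2 ⟨h1, hin⟩, fun h => h2 ((openConn_out_iff hv hn ha hb).1 h)⟩
  have s_ab : (AB \ (In ∩ (AB ∩ AV))) ∩ (bad S v)ᶜ ⊆ openConn a b ∩ (openConn a c)ᶜ := by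
    rintro ω ⟨⟨h1, h2⟩, hn⟩
    refine ⟨(openConn_out_iff hv hn ha hb).2 h1, fun h => h2 ?_⟩
    obtain ⟨hav, hin⟩ := (openConn_ac_iff hv hn ha hc).1 h
    exact ⟨hin, h1, hav⟩
  -- (2) probabilities
  set θ := (prodBernoulli w).real (openConn a b) with hθdef
  set r := (prodBernoulli w).real In with hrdef
  have hθ : θ = (prodBernoulli w).real AB := by rw [hθdef, ← nul (openConn a b), e_ab, nul]
  have hθc : (prodBernoulli w).real (openConn a b)ᶜ = 1 - θ := probReal_compl_eq_one_sub MeasurableSet.of_discrete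
  have g1 : (prodBernoulli w).real (openConn a b ∩ (openConn a v)ᶜ) = (prodBernoulli w).real (AB ∩ AVᶜ) := by
    rw [← nul (openConn a b ∩ (openConn a v)ᶜ), e_abav, nul]
  have g2 : (prodBernoulli w).real (openConn a v ∩ (openConn a b)ᶜ) = (prodBernoulli w).real (AV ∩ ABᶜ) := by
    rw [← nul (openConn a v ∩ (openConn a b)ᶜ), e_avab, nul]
  have g3 : (prodBernoulli w).real (openConn b v ∩ (openConn a b)ᶜ) = (prodBernoulli w).real (BV ∩ ABᶜ) := by
    rw [← nul (openConn b v ∩ (openConn a b)ᶜ), e_bvab, nul]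
  have c2 : r * (prodBernoulli w).real (AV ∩ ABᶜ) ≤ (prodBernoulli w).real (openConn a c ∩ (openConn a b)ᶜ) := by
    rw [← hind (hdAV.inter (OneLayerTwoFinger.determinedBy_compl hdAB)), ← nul (In ∩ (AV ∩ ABᶜ))]
    exact measureReal_mono s_ac
  have c3 : r * (prodBernoulli w).real (BV ∩ ABᶜ) ≤ (prodBernoulli w).real (openConn b c ∩ (openConn a b)ᶜ) := by
    rw [← hind (hdBV.inter (OneLayerTwoFinger.determinedBy_compl hdAB)), ← nul (In ∩ (BV ∩ ABᶜ))]
    exact measureReal_mono s_bc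
  have c1 : θ - r * (θ - (prodBernoulli w).real (AB ∩ AVᶜ)) ≤ (prodBernoulli w).real (openConn a b ∩ (openConn a c)ᶜ) := by
    have hsplit := measureReal_sdiff_add_inter (μ := prodBernoulli w) (s := AB) (t := In ∩ (AB ∩ AV)) MeasurableSet.of_discrete
    have hi : (prodBernoulli w).real (AB ∩ (In ∩ (AB ∩ AV))) = r * (prodBernoulli w).real (AB ∩ AV) := by
      rw [show AB ∩ (In ∩ (AB ∩ AV)) = In ∩ (AB ∩ AV) by ext ω; simp only [mem_inter_iff]; tauto, hind (hdAB.inter hdAV)]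
    have hsplit2 := measureReal_inter_add_sdiff (μ := prodBernoulli w) (s := AB) (t := AV) MeasurableSet.of_discrete
    rw [Set.sdiff_eq] at hsplit2
    have hmono : (prodBernoulli w).real ((AB \ (In ∩ (AB ∩ AV))) ∩ (bad S v)ᶜ) ≤
        (prodBernoulli w).real (openConn a b ∩ (openConn a c)ᶜ) := measureReal_mono s_ab
    rw [nul] at hmono
    rw [hi] at hsplit
    have hAVc : (prodBernoulli w).real (AB ∩ AVᶜ) = (prodBernoulli w).real AB - (prodBernoulli w).real (AB ∩ AV) := by linarith
    rw [hAVc, hθ]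
    have hring : (prodBernoulli w).real AB - r * ((prodBernoulli w).real AB - ((prodBernoulli w).real AB - (prodBernoulli w).real (AB ∩ AV)))
        = (prodBernoulli w).real AB - r * (prodBernoulli w).real (AB ∩ AV) := by ring
    rw [hring]
    linarith
  -- ranges and assembly
  have hr0 : 0 ≤ r := measureReal_nonneg
  have hr1 : r ≤ 1 := measureReal_le_one
  have hθ0 : 0 ≤ θ := measureReal_nonneg
  have hθ1 : θ ≤ 1 := measureReal_le_one
  rw [g1, g2, g3, hθc] at hyp
  rw [hθc]
  have hsum : θ * (1 - r) + r * (θ * (1 - θ)) ≤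
      (prodBernoulli w).real (openConn a b ∩ (openConn a c)ᶜ) + (prodBernoulli w).real (openConn a c ∩ (openConn a b)ᶜ) +
        (prodBernoulli w).real (openConn b c ∩ (openConn a b)ᶜ) := by
    have hmul : r * (θ * (1 - θ)) ≤ r * ((prodBernoulli w).real (AB ∩ AVᶜ) + (prodBernoulli w).real (AV ∩ ABᶜ) +
        (prodBernoulli w).real (BV ∩ ABᶜ)) := mul_le_mul_of_nonneg_left hyp hr0
    nlinarith [c1, c2, c3, hmul]
  nlinarith [hsum, mul_nonneg (sq_nonneg θ) (sub_nonneg.2 hr1)]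

end Summit.CriticalPhenomena.PercolationContinuityZ3.Theorems.ThreePointVarianceBehindCutVertex
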